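import Summits.BirchSwinnertonDyer.BirchSwinnertonDyer.Theorems.ErratumRoadFiveSigmaLocalH1Card
import Literature.NumberTheory.EllipticCurves.JetchevSkinnerWan2017.SigmaLocalTotallySplitProofs
import Literature.NumberTheory.EllipticCurves.JetchevSkinnerWan2017.SigmaLocalCharIdeal
import Literature.NumberTheory.EllipticCurves.LocalTorsionAwayFromResidueCharProofs
import Literature.NumberTheory.EllipticCurves.PrimaryTorsionContinuousSMulProofs
import Literature.NumberTheory.EllipticCurves.SigmaEulerFactors
import HarnessLib

/-!
# The local `Σ`-atom at the TOTALLY SPLIT places (`c = κ(φ_w) = 0`), PROVED: the `c = 0` half of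
# K2 support 20495 `JSWSigmaLocalCharIdeal` (assembly of modules L3 + L4a + L4b)

Cell `bsd-stepL`, K2 route `ErratumRoadFive`, support item 20495 `JSWSigmaLocalCharIdeal`
(= `JetchevSkinnerWan2017.sigmaLocal_charIdeal_eulerFactor_mem_of_noTamagawaDefect`), seat
`bsd-stepL-imc-p1` (g13). THEOREMS ONLY (no definition, no named fact, no `sorry`).

**What is proved** (`sigmaLocal_of_isEulerDataAt_zero`): for an elliptic curve `E` over a number
field `K` (any `K : Type`, any `ℤ_p`-extension `κ` — the imaginary-quadratic ∕ anticyclotomic binders of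
the atom are not needed on this branch), a prime `p ≥ 3`, a finite place `w ∤ p` with Euler datum
`(Nw, t, 0)` (Frobenius exponent `c = 0`: `w` totally split in `K_∞`) and NO Tamagawa defect
(`NoTamagawaDefect p t 0`: `t` not split multiplicative, and not additive if `p = 3`), the Pontryagin
dual `X_w` of `H¹(K_w, T_pE ⊗ Λ^*(Ψ⁻¹))` is a finitely generated torsion `Λ`-module and
`eulerFactor p ℤ_[p] Nw t 0 ∈ Ch_Λ(X_w)` — the THREE CONJUNCTS of the atom at such a place. Chain:

* L3 (`JetchevSkinnerWan2017.moduleFinite_isTorsion_natCard_mem_charIdeal_of_isEulerDataAt_zero`,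
  defn-ty1 g9): f.g. + torsion + `#H¹(K_w, E[p^∞]) ∈ Ch_Λ(X_w)`, given `H¹(K_w, E[p^∞])` finite;
* L4a (`SigmaLocal.finite_and_natCard_h1_primaryTorsion_local`): `H¹(K_w, E[p^∞])` IS finite, of order
  `#E(K_w)[p^k]` for some `k ≥ 1` (Milne I 2.8 in the kernel);
* L4b (`WeierstrassCurve.natCard_primePowTorsion_dvd_natCard_reductionAt` ∕ `_dvd_of_nonsplit` ∕
  `_eq_one_of_hasAdditiveReductionAt`): `#E(K_w)[p^k]` divides `#Ẽ_w(k_w) = Nw + 1 − a_w` (good),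
  `Nw + 1` (non-split multiplicative, `p` odd), and is `1` (additive, `p ≥ 5`) — i.e. divides the
  INTEGER `P_w(1) = eulerFactor p ℤ_[p] Nw t 0` (`eulerFactor_zero`; `Nw = N(w) = #k_w` and
  `a_w = #k_w + 1 − #Ẽ_w(k_w)` by `IsEulerDataAt` ∕ `frobeniusTraceAt`), so `P_w ∈ Ch_Λ(X_w)` (an ideal).

HONEST FRAMING: this closes the TOTALLY SPLIT (`c = 0`) branch of the atom; the FINITELY DECOMPOSED
branch (`c ≠ 0`: every place over a prime split in `K`; Greenberg–Vatsal 2000 Prop. 2.4-type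
computation `Ch_Λ(H¹(K_w, M)^∨) = (P_w(Nw⁻¹γ_w))`, module L5) remains OPEN, so
`sigmaLocal_charIdeal_eulerFactor_mem_of_noTamagawaDefect` is NOT yet discharged; nothing about BSD is
claimed; closes: none (T7).

References: [JetchevSkinnerWan2017] §5.1 Remark (inert places), proof of Thm. 6.1.6; [PollackWeston2011]
Lemma 3.2; [Castella2018] Thm. 2.3 (2.7), Prop. 2.5; [GreenbergLNM1716] §3 Lemma 3.3; [MilneADT2006]
I Thm. 2.8; [SilvermanAEC2009] VII.2.1, VII.3.1, VII.6.1.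
-/

noncomputable section

open scoped Classical

open Field NumberField IsDedekindDomain WeierstrassCurve
open Literature.NumberTheory.EllipticCurves Literature.NumberTheory.GaloisRepresentations
  Literature.NumberTheory.EllipticCurves.BigGaloisRep Literature.NumberTheory.EllipticCurves.IwasawaCharacter
  Literature.NumberTheory.EllipticCurves.JetchevSkinnerWan2017

set_option autoImplicit false
-- the Theorems namespace of this sub repeats the summit name by design (D-0017 nested layout)
set_option linter.dupNamespace false

namespace Summit.BirchSwinnertonDyer.BirchSwinnertonDyer.Theorems.SigmaLocal

/-- **The local `Σ`-atom at a totally split place, PROVED** (the `c = 0` half of K2 support 20495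
`JSWSigmaLocalCharIdeal`): for `E` elliptic over a number field `K`, `p ≥ 3`, `κ` a `ℤ_p`-extension,
`w ∤ p` with Euler datum `(Nw, t, 0)` and `NoTamagawaDefect p t 0`, the Pontryagin dual of
`H¹(K_w, T_pE ⊗ Λ^*(Ψ⁻¹))` (Mathlib continuous `H¹` of the tree's co-induced big representation
restricted along `localMap K (Sum.inl w)`) is finitely generated and torsion over `Λ = ℤ_p⟦T⟧`, and
`eulerFactor p ℤ_[p] Nw t 0 ∈ Ch_Λ` of it: `#H¹(K_w, E[p^∞]) ∈ Ch_Λ` (L3 + L4a) and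
`#H¹(K_w, E[p^∞]) = #E(K_w)[p^k] ∣ P_w(1)` (L4a + L4b; `P_w(1) = #Ẽ_w(k_w)`, `Nw + 1`, `1`).
[cite: PollackWeston2011, Lemma 3.2 ("`ℋ_ℓ = H¹(K_ℓ, A_f) ⊗ Λ^∨`" at inert or ramified `ℓ`)]
[cite: Castella2018, Thm. 2.3 (2.7) and Prop. 2.5 with its proof (arXiv:1704.06608 pp. 5, 7)]
[cite: JetchevSkinnerWan2017, §5.1 Remark (inert `w`: `Ψ(Frob_w) = 1`, the factor `(1 − a_ℓℓ⁻¹ + ℓ⁻¹)(1 + a_ℓℓ⁻¹ + ℓ⁻¹)`)]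
[cite: GreenbergLNM1716, §3 Lemma 3.3 (p. 87)] -/
theorem sigmaLocal_of_isEulerDataAt_zero {K : Type} [Field K] [NumberField K]
    (E : WeierstrassCurve K) [E.IsElliptic] (p : ℕ) [Fact p.Prime] (hp : 3 ≤ p)
    (κ : ZpExtension K p) (w : HeightOneSpectrum (𝓞 K)) (hw : ((p : ℕ) : 𝓞 K) ∉ w.asIdeal)
    (Nw : ℕ) (t : LocalReductionData) (hdata : IsEulerDataAt E κ w Nw t 0)
    (hB : NoTamagawaDefect p t 0)
    [TopologicalSpace (IwasawaAlgebra p)]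
    [ContinuousSMul (IwasawaAlgebra p) (BigRepModule ℤ_[p] p (PrimaryTorsion (geomPoints E) p))] :
    Module.Finite (IwasawaAlgebra p) (CharacterModule (continuousCohomology 1
        ((AnticyclotomicBigGaloisRep κ (E.primaryTorsionGaloisRep p)).restrict
          (localMap K (Sum.inl w))).toTopRep)) ∧
      Module.IsTorsion (IwasawaAlgebra p) (CharacterModule (continuousCohomology 1
        ((AnticyclotomicBigGaloisRep κ (E.primaryTorsionGaloisRep p)).restrict
          (localMap K (Sum.inl w))).toTopRep)) ∧
      eulerFactor p ℤ_[p] Nw t 0 ∈ Module.charIdeal (IwasawaAlgebra p) (CharacterModule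
        (continuousCohomology 1
          ((AnticyclotomicBigGaloisRep κ (E.primaryTorsionGaloisRep p)).restrict
            (localMap K (Sum.inl w))).toTopRep)) := by
  haveI : ContinuousSMul ℤ_[p] (PrimaryTorsion (geomPoints E) p) := PrimaryTorsion.continuousSMul
  have hpprime : p.Prime := Fact.out
  have hpw : (p : 𝓞 K) ∉ w.asIdeal := hw
  -- L4a: `H¹(K_w, E[p^∞])` is finite of order `#E(K_w)[p^k]`
  obtain ⟨hfin, k, -, -, hcardk, -⟩ := finite_and_natCard_h1_primaryTorsion_local E p w hw
  haveI := hfin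
  -- L3: f.g. + torsion + `#H¹ ∈ Ch`
  obtain ⟨hfg, htors, hmem⟩ :=
    moduleFinite_isTorsion_natCard_mem_charIdeal_of_isEulerDataAt_zero E p κ w hw Nw t hdata
  refine ⟨hfg, htors, ?_⟩
  rw [hcardk] at hmem
  -- the Euler datum: `Nw = #k_w`
  obtain ⟨hNw, -, ht⟩ := hdata
  have hNwk : Nw = Nat.card (IsLocalRing.ResidueField (w.adicCompletionIntegers K)) := by
    rw [hNw, natCard_residueField_eq_residueCard]; rfl
  -- L4b by reduction type
  cases t with
  | good a =>
    obtain ⟨hgood, ha⟩ := ht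
    obtain ⟨m, hm⟩ := E.natCard_primePowTorsion_dvd_natCard_reductionAt w hgood hpw k
    rw [eulerFactor_zero]
    have hP : ((Nw : IwasawaAlgebra p) - (a : IwasawaAlgebra p) + 1) =
        ((Nat.card (nsmulAddMonoidHom (p ^ k) :
            (E.baseChange (w.adicCompletion K)).toAffine.Point →+ _).ker : ℕ) : IwasawaAlgebra p) *
          (m : IwasawaAlgebra p) := by
      rw [← Nat.cast_mul, ← hm, ha, frobeniusTraceAt_def, hNwk]
      push_cast
      ring
    change ((Nw : PowerSeries ℤ_[p]) - (a : PowerSeries ℤ_[p]) + 1) ∈ _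
    rw [show ((Nw : PowerSeries ℤ_[p]) - (a : PowerSeries ℤ_[p]) + 1) =
      ((Nw : IwasawaAlgebra p) - (a : IwasawaAlgebra p) + 1) from rfl, hP]
    exact Ideal.mul_mem_right _ _ hmem
  | splitMult => exact absurd rfl (hB rfl).1
  | nonsplitMult =>
    obtain ⟨hmult, hns⟩ := ht
    have hp2 : p ≠ 2 := by omega
    obtain ⟨m, hm⟩ := E.natCard_primePowTorsion_dvd_of_nonsplit w hmult hns hpprime hp2 hpw k
    rw [eulerFactor_zero]
    have hP : ((Nw : IwasawaAlgebra p) + 1) =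
        ((Nat.card (nsmulAddMonoidHom (p ^ k) :
            (E.baseChange (w.adicCompletion K)).toAffine.Point →+ _).ker : ℕ) : IwasawaAlgebra p) *
          (m : IwasawaAlgebra p) := by
      rw [← Nat.cast_mul, ← hm, hNwk]
      push_cast
      ring
    change ((Nw : PowerSeries ℤ_[p]) + 1) ∈ _
    rw [show ((Nw : PowerSeries ℤ_[p]) + 1) = ((Nw : IwasawaAlgebra p) + 1) from rfl, hP]
    exact Ideal.mul_mem_right _ _ hmem
  | additive =>
    have hp3 : p ≠ 3 := fun h3 => (hB rfl).2 h3 rfl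
    have hp5 : 5 ≤ p := by
      rcases hpprime.eq_two_or_odd' with h2 | hodd
      · omega
      · have h4 : p ≠ 4 := fun h4 => by
          rw [h4] at hpprime; exact absurd hpprime (by decide)
        omega
    have h1 := E.natCard_primePowTorsion_eq_one_of_hasAdditiveReductionAt w ht hpprime hp5 hpw k
    rw [h1, Nat.cast_one] at hmem
    rw [eulerFactor_zero]
    exact (Ideal.eq_top_of_isUnit_mem _ hmem isUnit_one).symm ▸ Submodule.mem_top

end Summit.BirchSwinnertonDyer.BirchSwinnertonDyer.Theorems.SigmaLocal

end
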